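import Summits.ABC.ABC.Theorems.IUTThetaPilotThetaPartIIDisplay
import Summits.ABC.ABC.Theorems.IUTThetaPilotJInvWlog
import Summits.ABC.ABC.Theorems.IUTThetaPilotGenEllTwo
import Summits.ABC.ABC.Theorems.IUTThetaPilotThetaPartIIStubThetaData
import Summits.ABC.ABC.Theorems.IUTThetaPilotThetaPartIIStubThetaDataPrelims
import Summits.ABC.ABC.Theorems.IUTThetaPilotThetaPartIIStubR4
import Summits.ABC.IUTFork.LDHGenuinePoint
import Summits.ABC.IUTFork.LDHGenuineTowerArithPinned
import HarnessLib

/-!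
# Crux `ThetaPartII` (stmt-ABC-19678, route `IUTThetaPilot`), RESHAPE-2 skeleton, (U) line: the crux — and `ABC` —
# from `stub_cor312` and `stub_hullRegime` ALONE

Proof-only helper of the abc-iut cell (seat abc-iut-c312-8, layer-2 skeleton holder; the (U)-line twin of abc-iut-S2's
display-P capstone). TAKES NO SIDE on [IUTchIII] Cor. 3.12. Mochizuki, *Inter-universal Teichmüller theory IV* (RIMS
manuscript Apr. 2020 = PRIMS **57** (2021)) Thm. 1.10 (pp. 22–31), Cor. 2.2 (ii) (pp. 41–48); [IUTchIII] Cor. 3.12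
(kurims p. 174, reading (U): the hull of the UNION of the possible images — print's `−|log(Θ)|`, ref-b B14 §1).

The registered skeleton of record (sha16 `3f4b202b4c999d58`, RESHAPE-2) composes the crux on the (U) line from
`stub_thetaData` (CLOSED, abc-iut-L5-t7 `ThetaPartII.stub_thetaData`), `stub_cor312` (OPEN — the disputed Corollary at the
Θ-volume data of the admissible Legendre points), `stub_R4` (CLOSED — abc-iut-S1 `ThetaPartII.stub_R4` over
`Cor22.ThetaVolumeDatumAt.R4_towerFact`, [IUTchIV] Thm. 1.10 Step (iii) (R4) p. 26 / Step (v) p. 28) and `stub_hullRegime`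
(OPEN — the hull estimate with print's constant `B_III(P,l)` OFF the slot-constant regime = VERDICT RISK ¶7; ON the regime it
is abc-iut-S3's LANDED pinned junction `PointDict.hullEstimateOf_BIII_pinned`, [IUTchIV] Thm. 1.10 Steps (ii)–(v) pp. 24–29).
This file lands that composition as THEOREMS of the tree, hypotheses = exactly the registered OPEN stub signatures:

* `hullVolume_of_R4_of_hullRegime` — `stub_R4`-signature → `stub_hullRegime`-signature → `stub_hullVolume`-signature (the
  skeleton's RESHAPE-2 theorem body: `by_cases` slot-constant); `hullVolume_of_hullRegime` — with `stub_R4` discharged BY NAME;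
* `ThetaPartII_of_cor312_of_hullRegime` — **the crux from the two OPEN (U)-stubs alone** (datum from `stub_thetaData`, squeeze
  `PointDict.logQAvoid_le_of_cor312AtDatum`, then abc-iut-S-d2's `ThetaPartIIDisplay.ThetaPartII_of_squeezeIII`);
* `ABC_of_cor312_of_hullRegime` — **`abc` from the same two OPEN stubs ALONE**, through the route's deciding theorem `closes`
  with BOTH supports now PROVED in the tree: `JInvWlog_proof` and abc-iut-S6's `genEllTwo_holds` ([GenEll] Thm. 2.1 at
  `Σ = {2}`, p422748, item stmt-ABC-19679); `ABC_of_cor312_of_hullRegime_of_genEllTwo` keeps the form with `GenEllTwo` as a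
  hypothesis (twin of abc-iut-S2's `ABC_of_cor312_of_hullVolume_of_genEllTwo`).
So on the (U) line the kernel now says: [IUTchIII] Cor. 3.12 (reading (U)) at the Θ-volume data of the admissible Legendre
points + the absorption of the (Ind1) slot residue by `B_III` at non-slot-constant data (RISK ¶7) ⟹ `abc`; everything else —
(P7) Θ-data, the tower arithmetic (ii)(iii)(R4)(v), Thm. 1.10's numerics, Cor. 2.2's reduction, [GenEll] — is PROVED.
CONDITIONAL theorems; nothing is asserted about their hypotheses; the item is NOT closed by this file.
[cite: Mochizuki2012, IUTchIV Thm. 1.10 pp. 22–31] [cite: Mochizuki2012, IUTchIV Cor. 2.2 (ii) pp. 41–48]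
[cite: Mochizuki2012, IUTchIII Cor. 3.12 p. 174] [claim: Mochizuki2012, status: disputed]
-/

noncomputable section

set_option linter.dupNamespace false

namespace Summit.ABC.ABC.Theorems.ThetaPartII

open Literature.NumberTheory.DiophantineGeometry.GenEll Literature.IUT.LogVolume Literature.IUT.HodgeTheaters
open Summit.ABC.IUTFork NumberField IsDedekindDomain Literature.NumberTheory.NumberFields

/-- **(ii′) on the (U) line from (R4) and the off-regime piece**: the registered `stub_hullVolume` signature
(`Cor22.HullVolumeAtDatum P l (B_III P l)` at every admissible `(P, l)`) follows from the registered `stub_R4` and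
`stub_hullRegime` signatures — ON the slot-constant regime by abc-iut-S3's pinned junction `PointDict.hullEstimateOf_BIII_pinned`
([IUTchIV] Thm. 1.10 Steps (ii)–(v)), OFF it by `stub_hullRegime` itself; `7 ≤ l` from (P6) (`seven_le_of_condP6`).
[cite: Mochizuki2012, IUTchIV Thm. 1.10 proof Steps (ii)–(v) p. 24–29] [claim: Mochizuki2012, status: disputed] -/
theorem hullVolume_of_R4_of_hullRegime
    (hR4 : ∀ P : NFPoint, P ∈ UP → ∀ l : ℕ, l.Prime → 5 ≤ l →
      Cor22.AdmitsCore P → Cor22.CondP2 P l → Cor22.CondP5 P l → Cor22.CondP6 P l →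
      ∀ T : Cor22.ThetaVolumeDatumAt P l,
        (letI := T.instFieldF; letI := T.instNumberFieldF; letI := T.instAlgebraF; letI := T.instFieldK
         letI := T.instNumberFieldK; letI := T.instAlgebraK; letI := T.instFieldFbar; letI := T.instAlgebraFbar
         letI := T.instAlgebraKFbar; letI := T.instIsElliptic
         ∀ (p : ℕ) [hp : Fact p.Prime], p ∈ T.I.supportPrimes → ∀ v : placesOver (fieldOfModuli T.E) p,
           p - 2 < absRamificationIdx p ((T.I.σ.localFieldFamily p hp.out).k v) →
             p ≤ 2 ^ 12 * 3 ^ 3 * 5 * Cor22.dmod P * l ∧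
               3 + Real.log (absRamificationIdx p ((T.I.σ.localFieldFamily p hp.out).k v)) ≤
                 4 * Real.log (((2 ^ 12 * 3 ^ 3 * 5 * Cor22.dmod P : ℕ) : ℝ) * l)))
    (hreg : ∀ P : NFPoint, P ∈ UP → ∀ l : ℕ, l.Prime → 5 ≤ l →
      Cor22.AdmitsCore P → Cor22.CondP2 P l → Cor22.CondP5 P l → Cor22.CondP6 P l →
      ∀ T : Cor22.ThetaVolumeDatumAt P l,
        (letI := T.instFieldF; letI := T.instNumberFieldF; letI := T.instAlgebraF; letI := T.instFieldK
         letI := T.instNumberFieldK; letI := T.instAlgebraK; letI := T.instFieldFbar; letI := T.instAlgebraFbar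
         letI := T.instAlgebraKFbar; letI := T.instIsElliptic
         ¬ (∀ p ∈ T.I.supportPrimes, ∀ v w : placesOver (fieldOfModuli T.E) p,
            (Summit.ABC.IUTFork.DHData.ofInput T.I).logQloc p v = (Summit.ABC.IUTFork.DHData.ofInput T.I).logQloc p w)) →
        T.HullEstimateOf
          (((l : ℝ) + 1) / 4 *
            ((1 + 12 * (Cor22.dmod P : ℝ) / l) * (P.logDiff + Cor22.logCondAvoid P {2, l})
              + 2 * Real.log l + 52
              + 20 / 3 * Real.log (((2 ^ 12 * 3 ^ 3 * 5 * Cor22.dmod P : ℕ) : ℝ) * (l : ℝ))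
                * (Nat.primeCounting (2 ^ 12 * 3 ^ 3 * 5 * Cor22.dmod P * l) : ℝ)))) :
    ∀ P : NFPoint, P ∈ UP → ∀ l : ℕ, l.Prime → 5 ≤ l →
      Cor22.AdmitsCore P → Cor22.CondP2 P l → Cor22.CondP5 P l → Cor22.CondP6 P l →
      Cor22.HullVolumeAtDatum P l
        (((l : ℝ) + 1) / 4 *
          ((1 + 12 * (Cor22.dmod P : ℝ) / l) * (P.logDiff + Cor22.logCondAvoid P {2, l})
            + 2 * Real.log l + 52
            + 20 / 3 * Real.log (((2 ^ 12 * 3 ^ 3 * 5 * Cor22.dmod P : ℕ) : ℝ) * (l : ℝ))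
              * (Nat.primeCounting (2 ^ 12 * 3 ^ 3 * 5 * Cor22.dmod P * l) : ℝ))) := by
  intro P hP l hl h5 hcore h2 hP5 h6 T
  have h7 : 7 ≤ l := seven_le_of_condP6 hP hl h5 h6
  letI := T.instFieldF; letI := T.instNumberFieldF; letI := T.instAlgebraF; letI := T.instFieldK
  letI := T.instNumberFieldK; letI := T.instAlgebraK; letI := T.instFieldFbar; letI := T.instAlgebraFbar
  letI := T.instAlgebraKFbar; letI := T.instIsElliptic
  by_cases hc : ∀ p ∈ T.I.supportPrimes, ∀ v w : placesOver (fieldOfModuli T.E) p,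
      (Summit.ABC.IUTFork.DHData.ofInput T.I).logQloc p v = (Summit.ABC.IUTFork.DHData.ofInput T.I).logQloc p w
  · exact Summit.ABC.IUTFork.PointDict.hullEstimateOf_BIII_pinned T hP h7 (hR4 P hP l hl h5 hcore h2 hP5 h6 T) hc
  · exact hreg P hP l hl h5 hcore h2 hP5 h6 T hc

/-- **(ii′) on the (U) line from the off-regime piece ALONE** — `stub_R4` discharged BY NAME (abc-iut-S1's
`ThetaPartII.stub_R4`, [IUTchIV] Thm. 1.10 Step (iii) (R4) p. 26 / Step (v) p. 28, over
`Cor22.ThetaVolumeDatumAt.R4_towerFact`). [cite: Mochizuki2012, IUTchIV Thm. 1.10 proof Steps (ii)–(v) p. 24–29]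
[claim: Mochizuki2012, status: disputed] -/
theorem hullVolume_of_hullRegime
    (hreg : ∀ P : NFPoint, P ∈ UP → ∀ l : ℕ, l.Prime → 5 ≤ l →
      Cor22.AdmitsCore P → Cor22.CondP2 P l → Cor22.CondP5 P l → Cor22.CondP6 P l →
      ∀ T : Cor22.ThetaVolumeDatumAt P l,
        (letI := T.instFieldF; letI := T.instNumberFieldF; letI := T.instAlgebraF; letI := T.instFieldK
         letI := T.instNumberFieldK; letI := T.instAlgebraK; letI := T.instFieldFbar; letI := T.instAlgebraFbar
         letI := T.instAlgebraKFbar; letI := T.instIsElliptic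
         ¬ (∀ p ∈ T.I.supportPrimes, ∀ v w : placesOver (fieldOfModuli T.E) p,
            (Summit.ABC.IUTFork.DHData.ofInput T.I).logQloc p v = (Summit.ABC.IUTFork.DHData.ofInput T.I).logQloc p w)) →
        T.HullEstimateOf
          (((l : ℝ) + 1) / 4 *
            ((1 + 12 * (Cor22.dmod P : ℝ) / l) * (P.logDiff + Cor22.logCondAvoid P {2, l})
              + 2 * Real.log l + 52
              + 20 / 3 * Real.log (((2 ^ 12 * 3 ^ 3 * 5 * Cor22.dmod P : ℕ) : ℝ) * (l : ℝ))
                * (Nat.primeCounting (2 ^ 12 * 3 ^ 3 * 5 * Cor22.dmod P * l) : ℝ)))) :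
    ∀ P : NFPoint, P ∈ UP → ∀ l : ℕ, l.Prime → 5 ≤ l →
      Cor22.AdmitsCore P → Cor22.CondP2 P l → Cor22.CondP5 P l → Cor22.CondP6 P l →
      Cor22.HullVolumeAtDatum P l
        (((l : ℝ) + 1) / 4 *
          ((1 + 12 * (Cor22.dmod P : ℝ) / l) * (P.logDiff + Cor22.logCondAvoid P {2, l})
            + 2 * Real.log l + 52
            + 20 / 3 * Real.log (((2 ^ 12 * 3 ^ 3 * 5 * Cor22.dmod P : ℕ) : ℝ) * (l : ℝ))
              * (Nat.primeCounting (2 ^ 12 * 3 ^ 3 * 5 * Cor22.dmod P * l) : ℝ))) :=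
  hullVolume_of_R4_of_hullRegime stub_R4 hreg

/-- **The crux `ThetaPartII` from the two OPEN (U)-stubs ALONE**: [IUTchIII] Cor. 3.12 in reading (U) at every genuine
Θ-volume datum of every admissible `(P, l)` (`stub_cor312`) and the off-regime hull estimate (`stub_hullRegime`) imply
[IUTchIV] Cor. 2.2 (ii) in its uniform form — child (i) by abc-iut-L5-t7's `stub_thetaData`, (R4) by abc-iut-S1's `stub_R4`,
the squeeze by abc-iut-S2's `PointDict.logQAvoid_le_of_cor312AtDatum`, Thm. 1.10's Step (viii) arithmetic by abc-iut-S-d2's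
`ThetaPartIIDisplay.ThetaPartII_of_squeezeIII`. CONDITIONAL; does not close the item.
[cite: Mochizuki2012, IUTchIV Cor. 2.2 (ii) pp. 41–48] [claim: Mochizuki2012, status: disputed] -/
theorem ThetaPartII_of_cor312_of_hullRegime
    (h312 : ∀ P : NFPoint, P ∈ UP → ∀ l : ℕ, l.Prime → 5 ≤ l →
      Cor22.AdmitsCore P → Cor22.CondP2 P l → Cor22.CondP5 P l → Cor22.CondP6 P l →
        Cor22.Cor312AtDatum P l)
    (hreg : ∀ P : NFPoint, P ∈ UP → ∀ l : ℕ, l.Prime → 5 ≤ l →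
      Cor22.AdmitsCore P → Cor22.CondP2 P l → Cor22.CondP5 P l → Cor22.CondP6 P l →
      ∀ T : Cor22.ThetaVolumeDatumAt P l,
        (letI := T.instFieldF; letI := T.instNumberFieldF; letI := T.instAlgebraF; letI := T.instFieldK
         letI := T.instNumberFieldK; letI := T.instAlgebraK; letI := T.instFieldFbar; letI := T.instAlgebraFbar
         letI := T.instAlgebraKFbar; letI := T.instIsElliptic
         ¬ (∀ p ∈ T.I.supportPrimes, ∀ v w : placesOver (fieldOfModuli T.E) p,
            (Summit.ABC.IUTFork.DHData.ofInput T.I).logQloc p v = (Summit.ABC.IUTFork.DHData.ofInput T.I).logQloc p w)) →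
        T.HullEstimateOf
          (((l : ℝ) + 1) / 4 *
            ((1 + 12 * (Cor22.dmod P : ℝ) / l) * (P.logDiff + Cor22.logCondAvoid P {2, l})
              + 2 * Real.log l + 52
              + 20 / 3 * Real.log (((2 ^ 12 * 3 ^ 3 * 5 * Cor22.dmod P : ℕ) : ℝ) * (l : ℝ))
                * (Nat.primeCounting (2 ^ 12 * 3 ^ 3 * 5 * Cor22.dmod P * l) : ℝ)))) :
    Summit.ABC.ABC.Theses.IUTThetaPilot.ThetaPartII :=
  ThetaPartIIDisplay.ThetaPartII_of_squeezeIII fun P hP l hl h5 hcore hP2 hP5 h6 => by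
    obtain ⟨T⟩ := stub_thetaData P hP l hl h5 hcore hP2 hP5 h6
    exact Summit.ABC.IUTFork.PointDict.logQAvoid_le_of_cor312AtDatum (h312 P hP l hl h5 hcore hP2 hP5 h6)
      (hullVolume_of_hullRegime hreg P hP l hl h5 hcore hP2 hP5 h6) T hP.1

/-- **`ABC` from the two OPEN (U)-stubs and the support `GenEllTwo`**: [IUTchIII] Cor. 3.12 (reading (U)) at the Θ-data of
the `λ`-line, the off-regime hull estimate (RISK ¶7), and [GenEll] Thm. 2.1 at `Σ = {2}` imply the `abc` conjecture — through
the route's deciding theorem `closes` and the proved `JInvWlog_proof`. Nothing is asserted unconditionally; no side taken.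
[cite: Mochizuki2012, IUTchIV Cor. 2.2–2.3 pp. 41–55] [claim: Mochizuki2012, status: disputed] -/
theorem ABC_of_cor312_of_hullRegime_of_genEllTwo
    (h312 : ∀ P : NFPoint, P ∈ UP → ∀ l : ℕ, l.Prime → 5 ≤ l →
      Cor22.AdmitsCore P → Cor22.CondP2 P l → Cor22.CondP5 P l → Cor22.CondP6 P l →
        Cor22.Cor312AtDatum P l)
    (hreg : ∀ P : NFPoint, P ∈ UP → ∀ l : ℕ, l.Prime → 5 ≤ l →
      Cor22.AdmitsCore P → Cor22.CondP2 P l → Cor22.CondP5 P l → Cor22.CondP6 P l →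
      ∀ T : Cor22.ThetaVolumeDatumAt P l,
        (letI := T.instFieldF; letI := T.instNumberFieldF; letI := T.instAlgebraF; letI := T.instFieldK
         letI := T.instNumberFieldK; letI := T.instAlgebraK; letI := T.instFieldFbar; letI := T.instAlgebraFbar
         letI := T.instAlgebraKFbar; letI := T.instIsElliptic
         ¬ (∀ p ∈ T.I.supportPrimes, ∀ v w : placesOver (fieldOfModuli T.E) p,
            (Summit.ABC.IUTFork.DHData.ofInput T.I).logQloc p v = (Summit.ABC.IUTFork.DHData.ofInput T.I).logQloc p w)) →
        T.HullEstimateOf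
          (((l : ℝ) + 1) / 4 *
            ((1 + 12 * (Cor22.dmod P : ℝ) / l) * (P.logDiff + Cor22.logCondAvoid P {2, l})
              + 2 * Real.log l + 52
              + 20 / 3 * Real.log (((2 ^ 12 * 3 ^ 3 * 5 * Cor22.dmod P : ℕ) : ℝ) * (l : ℝ))
                * (Nat.primeCounting (2 ^ 12 * 3 ^ 3 * 5 * Cor22.dmod P * l) : ℝ))))
    (hG : Summit.ABC.ABC.Theses.IUTThetaPilot.GenEllTwo) : _root_.ABC :=
  Summit.ABC.ABC.Theses.IUTThetaPilot.closes (ThetaPartII_of_cor312_of_hullRegime h312 hreg) hG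
    Summit.ABC.ABC.Theorems.JInvWlog_proof

/-- **`abc` FROM THE TWO OPEN (U)-STUBS ALONE**: [IUTchIII] Cor. 3.12 in reading (U) at the Θ-volume data of every
admissible `(P, l)` of the `λ`-line (`stub_cor312`, DISPUTED, hypothesis) and the off-regime hull estimate (`stub_hullRegime`,
VERDICT RISK ¶7, hypothesis) imply the `abc` conjecture — every other input of the route is a THEOREM of the tree: child (i)
(abc-iut-L5-t7 `stub_thetaData`), (R4) (abc-iut-S1 `stub_R4`), the slot-constant hull estimate (abc-iut-S3), the squeeze and
Thm. 1.10 / Cor. 2.2 (ii) reductions (abc-iut-S2 / S-d2 / S3), `JInvWlog_proof`, and [GenEll] Thm. 2.1 at `Σ = {2}`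
(abc-iut-S6 `genEllTwo_holds`). CONDITIONAL; nothing is asserted about the two hypotheses; no side taken.
[cite: Mochizuki2012, IUTchIV Cor. 2.2–2.3 pp. 41–55] [cite: Mochizuki2012, IUTchIII Cor. 3.12 p. 174]
[claim: Mochizuki2012, status: disputed] -/
theorem ABC_of_cor312_of_hullRegime
    (h312 : ∀ P : NFPoint, P ∈ UP → ∀ l : ℕ, l.Prime → 5 ≤ l →
      Cor22.AdmitsCore P → Cor22.CondP2 P l → Cor22.CondP5 P l → Cor22.CondP6 P l →
        Cor22.Cor312AtDatum P l)
    (hreg : ∀ P : NFPoint, P ∈ UP → ∀ l : ℕ, l.Prime → 5 ≤ l →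
      Cor22.AdmitsCore P → Cor22.CondP2 P l → Cor22.CondP5 P l → Cor22.CondP6 P l →
      ∀ T : Cor22.ThetaVolumeDatumAt P l,
        (letI := T.instFieldF; letI := T.instNumberFieldF; letI := T.instAlgebraF; letI := T.instFieldK
         letI := T.instNumberFieldK; letI := T.instAlgebraK; letI := T.instFieldFbar; letI := T.instAlgebraFbar
         letI := T.instAlgebraKFbar; letI := T.instIsElliptic
         ¬ (∀ p ∈ T.I.supportPrimes, ∀ v w : placesOver (fieldOfModuli T.E) p,
            (Summit.ABC.IUTFork.DHData.ofInput T.I).logQloc p v = (Summit.ABC.IUTFork.DHData.ofInput T.I).logQloc p w)) →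
        T.HullEstimateOf
          (((l : ℝ) + 1) / 4 *
            ((1 + 12 * (Cor22.dmod P : ℝ) / l) * (P.logDiff + Cor22.logCondAvoid P {2, l})
              + 2 * Real.log l + 52
              + 20 / 3 * Real.log (((2 ^ 12 * 3 ^ 3 * 5 * Cor22.dmod P : ℕ) : ℝ) * (l : ℝ))
                * (Nat.primeCounting (2 ^ 12 * 3 ^ 3 * 5 * Cor22.dmod P * l) : ℝ)))) :
    _root_.ABC :=
  ABC_of_cor312_of_hullRegime_of_genEllTwo h312 hreg Summit.ABC.ABC.Theorems.genEllTwo_holds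

end Summit.ABC.ABC.Theorems.ThetaPartII

end
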